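/-
Copyright (c) 2026 the pub-hodgecm-mathlib formalisation cell (harness21).  Prover seat hodgecm-mathlib-B-p14 (g33), 2026-09-01.  Road «W′» = «R1LL-WILD»
(architect A-p16 (g28), LEAD F0P3a-plan (g10) WORD T9-25): the (W′2)↔(W′1)∕(W′3) SEAM — value laws at fixed vertices from commuting shell representatives.
-/
import Literature.GroupTheory.FixedPointsOrbitMapTransport   -- ★ p843911 (this seat, W′2 pure half): `act_apply_eq_act_apply_iff_inv_mul_mem`, `finsum_mem_fixedBy_quotient_conj_eq_finsum_fixedPoints_of_vertexAction`
import HarnessLib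

/-!
# Value laws at fixed vertices from commuting shell representatives
# `act g x₀ = act (t r) x₀`, `t γ = γ t` ⇒ `φ (g⁻¹ γ g) = φ (r⁻¹ γ r)`

Topic `GroupTheory`; namespace `Literature.GroupTheory` (that of ★ `FixedPointsOrbitMapTransport`).  THEOREMS ONLY (no definition, no instance, no notation, no named
fact, no `sorry`); Mathlib-only; kernel lane.  Cell `pub/hodgecm-mathlib`, crux H413 = stmt-HodgeConjecture-24833; road «W′» = «R1LL-WILD» (the wildly ramified residue
of the rank-one unstable transfer letter; architect A-p16 (g28)); this file is the SEAM between (W′2) «weighted unfolding on the vertices» (★ p843911 ∕ p843922, this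
seat) and (W′1) «the torus in the tree» (★ p843889, A-p17 (g23): the torus acts on each shell `m` of the tree of `SL₂(F)` through the representative `r_m = diag(1, ϖ^m)`,
and a torus unit fixes whole shells) ∕ (W′3) «the class at a shell-`m` vertex» (p08 (g15)).
HONEST LABEL: HC_CM is proved only modulo the cell's remaining named inputs (hLiu418, h413) until rung 0 closes; elementary group theory, print cited for orientation.

THE MATHEMATICS [LabesseLanglands1979 §2 p. 8; Labesse, *Stabilisation et germes pour SL(2)*, Prop. 0.0.10–0.0.11: `∫_{T∖G̃} f(x̃⁻¹ γ x̃) dx̃ =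
Σ_m C(ϖ^{−m}) ∫_K f(k⁻¹ α_m⁻¹ γ α_m k) dk`; Kottwitz1986 §3].  Let `Γ` act on `W` (`act`, `act 1 = id`, `act (g h) = act g ∘ act h`), `Kv = Stab(x₀)`, and let `φ` be
invariant under `Kv`-conjugation.  If a `γ`-fixed vertex `x` is reached as `x = act (t · r) x₀` with `t` COMMUTING with `γ` (an element of the torus `Z(γ)`) and `r` a
chosen representative, then for EVERY `g` with `act g x₀ = x` one has `g = t r k`, `k ∈ Kv`, so `φ (g⁻¹ γ g) = φ (k⁻¹ (r⁻¹ γ r) k) = φ (r⁻¹ γ r)`: the summand of the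
weighted unfolding depends on the fixed vertex only through its SHELL representative.  With a shell index `d : W → ℕ` and representatives `r : ℕ → Γ` this is exactly the
`hval` binder of ★ `finsum_mem_fixedBy_quotient_conj_eq_finsum_fixedPoints_of_vertexAction` with `val x := φ (r_{d x}⁻¹ γ r_{d x})`, and regrouping by `d` gives the
SHELL SUM `Σ_{i ≤ N} #{x ∈ Fix_W(γ) | d x = i} • φ (r_i⁻¹ γ r_i)` — Labesse–Langlands' `Σ_m C_m(γ) f(α_m⁻¹ γ α_m)` with `C_m(γ)` the number of fixed shell-`m`
vertices ((W′1): `2q^m` or `0`).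

* `conj_apply_eq_conj_apply_rep_of_act_eq_of_commute`, `conj_apply_eq_conj_apply_shellRep_of_vertexAction` (the `hval` binder discharged),
  `finsum_mem_fixedBy_quotient_conj_eq_finsum_fixedPoints_shellRep_of_vertexAction`, `finsum_mem_eq_sum_ncard_fiber_smul` (regrouping `Σᶠ_{x∈S} w (d x) =
  Σ_{i≤N} #{x ∈ S | d x = i} • w i`), `finsum_mem_fixedPoints_shellRep_eq_sum_ncard_smul` (the shell sum).

## References
* [LabesseLanglands1979] J.-P. Labesse, R. P. Langlands, *L-indistinguishability for SL(2)*, Canad. J. Math. 31 (1979): §2 p. 8.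
* [Kottwitz1986] R. E. Kottwitz, *Base change for unit elements of Hecke algebras*, Compositio Math. 60 (1986): §3.
* [Serre1980Trees] J.-P. Serre, *Trees* (1980): Ch. II §1.3 (stabilisers of vertices of the tree of `SL₂`).
-/

set_option autoImplicit false

open Set Function MulAction

namespace Literature.GroupTheory

/-! ## §1 Value laws from COMMUTING SHELL REPRESENTATIVES (the (W′1)∕(W′3) seam)

If every `γ`-fixed vertex `x` is reached as `x = act (t · r_{d x}) x₀` with `t` COMMUTING with `γ` (an element of the torus `Z(γ)`) and `r_i` a fixed
representative of the shell `i = d x` (Labesse–Langlands: `r_m = diag(1, ϖ^m)`, the torus acts transitively on each shell — ★ (W′1)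
`SLTwoTreeQuadraticTorusFixedShells` I∕II), then for a test function `φ` invariant under `Kv`-conjugation the value `φ (g⁻¹ γ g)` at ANY `g` over `x`
is `φ (r_{d x}⁻¹ γ r_{d x})`: it depends on the fixed vertex only through its SHELL.  This is the `hval` binder of §2 with `val x := φ (r_{d x}⁻¹ γ r_{d x})`,
discharged once and for all. [LabesseLanglands1979 §2 p. 8, Prop.: `∫_{T∖G} f(x⁻¹ γ x) = Σ_m C(ϖ^{−m}) ∫_K f(k⁻¹ α_m⁻¹ γ α_m k)`] -/

section Shells

variable {Γ : Type*} [Group Γ] {W : Type*} (act : Γ → W → W) (act_one : ∀ x : W, act 1 x = x)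
  (act_mul : ∀ (g h : Γ) (x : W), act (g * h) x = act g (act h x))
  {x₀ : W} (Kv : Subgroup Γ) (hKv : ∀ g : Γ, g ∈ Kv ↔ act g x₀ = x₀) (γ : Γ)

include act_one act_mul hKv in
/-- **The value at a fixed vertex reached through the centraliser**: if `act g x₀ = act (t r) x₀` with `t γ = γ t`, then for `φ` invariant under `Kv`-conjugation
`φ (g⁻¹ γ g) = φ (r⁻¹ γ r)` — indeed `g = t r k` with `k ∈ Kv` and `g⁻¹ γ g = k⁻¹ (r⁻¹ γ r) k`. [cite: LabesseLanglands1979, §2 p. 8] [cite: Kottwitz1986, §3] -/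
theorem conj_apply_eq_conj_apply_rep_of_act_eq_of_commute {E : Type*} (φ : Γ → E) (hφK : ∀ k ∈ Kv, ∀ y : Γ, φ (k * y * k⁻¹) = φ y)
    {g t r : Γ} (ht : t * γ = γ * t) (hg : act g x₀ = act (t * r) x₀) : φ (g⁻¹ * γ * g) = φ (r⁻¹ * γ * r) := by
  have hk : (t * r)⁻¹ * g ∈ Kv := (act_apply_eq_act_apply_iff_inv_mul_mem act act_one act_mul Kv hKv (t * r) g).1 hg.symm
  have htγ : t⁻¹ * γ * t = γ := by rw [mul_assoc, ← ht, inv_mul_cancel_left]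
  have hconj : g⁻¹ * γ * g = ((t * r)⁻¹ * g)⁻¹ * (r⁻¹ * (t⁻¹ * γ * t) * r) * ((t * r)⁻¹ * g)⁻¹⁻¹ := by group
  rw [hconj, htγ, hφK _ (Kv.inv_mem hk)]

include act_one act_mul hKv in
/-- **THE SHELL VALUE LAW** (the `hval` binder of `finsum_mem_fixedBy_quotient_conj_eq_finsum_fixedPoints_of_vertexAction`, discharged): given a shell index
`d : W → ℕ` and shell representatives `r : ℕ → Γ` such that every `γ`-FIXED vertex `x` is `act (t · r (d x)) x₀` for some `t` commuting with `γ`, and `φ` invariant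
under `Kv`-conjugation, `φ (g⁻¹ γ g) = φ ((r (d x))⁻¹ γ (r (d x)))` at `x = act g x₀` fixed. [cite: LabesseLanglands1979, §2 p. 8] [cite: Kottwitz1986, §3] -/
theorem conj_apply_eq_conj_apply_shellRep_of_vertexAction {E : Type*} (φ : Γ → E) (hφK : ∀ k ∈ Kv, ∀ y : Γ, φ (k * y * k⁻¹) = φ y)
    (d : W → ℕ) (r : ℕ → Γ) (hshell : ∀ x : W, act γ x = x → ∃ t : Γ, t * γ = γ * t ∧ act (t * r (d x)) x₀ = x)
    (g : Γ) (hg : act γ (act g x₀) = act g x₀) : φ (g⁻¹ * γ * g) = φ ((r (d (act g x₀)))⁻¹ * γ * r (d (act g x₀))) := by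
  obtain ⟨t, ht, hx⟩ := hshell (act g x₀) hg
  exact conj_apply_eq_conj_apply_rep_of_act_eq_of_commute act act_one act_mul Kv hKv γ φ hφK ht hx.symm

variable (hV : ∀ x : W, ∃ g : Γ, act g x₀ = x)

include act_one act_mul hV hKv in
/-- **THE WEIGHTED FIXED-POINT SUM, SHELL FORM**: under the shell hypothesis, `Σᶠ_{q ∈ Fix_γ(Γ ⧸ Kv)} φ (q.out⁻¹ γ q.out) = Σᶠ_{x ∈ Fix_W(γ)} φ (r_{d x}⁻¹ γ r_{d x})`.
[cite: LabesseLanglands1979, §2 p. 8] [cite: Kottwitz1986, §3] -/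
theorem finsum_mem_fixedBy_quotient_conj_eq_finsum_fixedPoints_shellRep_of_vertexAction {E : Type*} [AddCommMonoid E] (φ : Γ → E)
    (hφK : ∀ k ∈ Kv, ∀ y : Γ, φ (k * y * k⁻¹) = φ y) (d : W → ℕ) (r : ℕ → Γ)
    (hshell : ∀ x : W, act γ x = x → ∃ t : Γ, t * γ = γ * t ∧ act (t * r (d x)) x₀ = x) :
    ∑ᶠ q ∈ fixedBy (Γ ⧸ Kv) γ, φ (q.out⁻¹ * γ * q.out) = ∑ᶠ x ∈ {x : W | act γ x = x}, φ ((r (d x))⁻¹ * γ * r (d x)) :=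
  finsum_mem_fixedBy_quotient_conj_eq_finsum_fixedPoints_of_vertexAction act act_one act_mul hV Kv hKv γ φ
    (fun x => φ ((r (d x))⁻¹ * γ * r (d x))) (conj_apply_eq_conj_apply_shellRep_of_vertexAction act act_one act_mul Kv hKv γ φ hφK d r hshell)

/-- **Regrouping a finite sum by an `ℕ`-valued index with a bound** (untruncated twin of ★ `finsum_mem_eq_ncard_smul_add_sum_ncard_smul`): if `val x = w (d x)` on a finite
set `S` on which `d ≤ N`, then `Σᶠ_{x ∈ S} val x = Σ_{i ≤ N} #{x ∈ S | d x = i} • w i`. [cite: LabesseLanglands1979, §2 p. 8] -/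
theorem finsum_mem_eq_sum_ncard_fiber_smul {E : Type*} [AddCommMonoid E] {S : Set W} (hS : S.Finite) (val : W → E) (d : W → ℕ) (N : ℕ) (w : ℕ → E)
    (hval : ∀ x ∈ S, val x = w (d x)) (hN : ∀ x ∈ S, d x ≤ N) :
    ∑ᶠ x ∈ S, val x = ∑ i ∈ Finset.range (N + 1), {x ∈ S | d x = i}.ncard • w i := by
  classical
  rw [finsum_mem_eq_finite_toFinset_sum _ hS]
  have hfib : ∀ i, ({x ∈ S | d x = i}).ncard = (hS.toFinset.filter fun x => d x = i).card := fun i => by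
    rw [Set.ncard_eq_toFinset_card _ (hS.subset fun x hx => hx.1)]
    congr 1
    ext x
    simp only [Finset.mem_filter, Set.Finite.mem_toFinset, Set.mem_setOf_eq]
  calc ∑ x ∈ hS.toFinset, val x
      = ∑ x ∈ hS.toFinset, w (d x) := Finset.sum_congr rfl fun x hx => hval x ((Set.Finite.mem_toFinset hS).1 hx)
    _ = ∑ i ∈ Finset.range (N + 1), ∑ x ∈ hS.toFinset with d x = i, w (d x) :=
        (Finset.sum_fiberwise_of_maps_to (g := d) (fun x hx => Finset.mem_range.2
          (Nat.lt_succ_of_le (hN x ((Set.Finite.mem_toFinset hS).1 hx)))) _).symm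
    _ = ∑ i ∈ Finset.range (N + 1), {x ∈ S | d x = i}.ncard • w i := by
        refine Finset.sum_congr rfl fun i _ => ?_
        rw [hfib i, ← Finset.sum_const]
        exact Finset.sum_congr rfl fun x hx => by rw [(Finset.mem_filter.1 hx).2]

include act_one act_mul hV hKv in
/-- **THE SHELL SUM** (Labesse–Langlands' `Σ_m C_m(γ) f(α_m⁻¹ γ α_m)`): under the shell hypothesis, with finitely many fixed vertices all of shell index `≤ N`,
`Σᶠ_{q ∈ Fix_γ(Γ ⧸ Kv)} φ (q.out⁻¹ γ q.out) = Σ_{i ≤ N} #{x ∈ Fix_W(γ) | d x = i} • φ (r_i⁻¹ γ r_i)`. [cite: LabesseLanglands1979, §2 p. 8] [cite: Kottwitz1986, §3] -/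
theorem finsum_mem_fixedBy_quotient_conj_eq_sum_ncard_shell_smul_of_vertexAction {E : Type*} [AddCommMonoid E] (φ : Γ → E)
    (hφK : ∀ k ∈ Kv, ∀ y : Γ, φ (k * y * k⁻¹) = φ y) (d : W → ℕ) (r : ℕ → Γ) (N : ℕ)
    (hshell : ∀ x : W, act γ x = x → ∃ t : Γ, t * γ = γ * t ∧ act (t * r (d x)) x₀ = x)
    (hfin : {x : W | act γ x = x}.Finite) (hN : ∀ x : W, act γ x = x → d x ≤ N) :
    ∑ᶠ q ∈ fixedBy (Γ ⧸ Kv) γ, φ (q.out⁻¹ * γ * q.out) =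
      ∑ i ∈ Finset.range (N + 1), {x : W | act γ x = x ∧ d x = i}.ncard • φ ((r i)⁻¹ * γ * r i) := by
  rw [finsum_mem_fixedBy_quotient_conj_eq_finsum_fixedPoints_shellRep_of_vertexAction act act_one act_mul Kv hKv γ hV φ hφK d r hshell,
    finsum_mem_eq_sum_ncard_fiber_smul hfin (fun x => φ ((r (d x))⁻¹ * γ * r (d x))) d N (fun i => φ ((r i)⁻¹ * γ * r i)) (fun _ _ => rfl) hN]
  simp only [Set.sep_setOf]

end Shells

end Literature.GroupTheory
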